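import Summits.Ventures.AbcShadow.SH04.TwoSigned
import Summits.Ventures.AbcShadow.SH04.PairRow

/-!
# Venture AbcShadow — SH-04 GENERIC ROW for a pair `(p, n)` of [BVY04, Thm 1.6], ALLOWED-SET-PARAMETRIC (the package AS AMENDED)

HONEST FRAMING. A row template of the work-bound cell `abc-shadow` (typer seat `abc-shadow-typ-1`, lineage g3): a CONDITIONAL,
typed/kernel-checked REDUCTION, no claim on abc or on any summit, no side on IUT. It is `SH04/PairRow.lean` VERBATIM with ONE change: the
admissible-trace function is a PARAMETER `Aset : ℕ → List ℤ` — package `BVY04PackageA Aset`, kernel eliminations `Eliminated Aset n`,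
distinguished-prime guards `MatchesModAt … Aset r` and transfer `LStarTransferA Aset …` (`SH04/TwoSigned.lean`). REASON: the cell's critic found
a print erratum ([BVY04, Lemma 2.1 (ii)] sign slip, memo crit-1-SH04-5911.md 812d2f7844b0b019 §2) making [Prop 4.2] sound only with the
TWO-SIGNED admissible sets; the rows of record are therefore re-instantiated at `Aset := bvy04Allowed` (the package AS AMENDED, which print's
package implies: `bvy04PackageB_of_print`) in the `…B` files, with every kernel certificate re-evaluated by `decide` on the two-signed sets
(all trees of this lineage were built for them). At `Aset := bvy04AllowedPrint` the theorems specialise to those of `SH04/PairRow.lean`.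
Kernel content and named inputs: as listed in `SH04/PairRow.lean`. Words: typed/kernel-checked REDUCTION; the newform data is COMPUTED
(certificate 4a36c28685fe0350) and enters as `DataComplete`; print inputs are NAMED hypotheses (package AS AMENDED, two-signed); the L\*
congruence is COMPUTED + CITED and enters as ONE named hypothesis per surviving orbit; adjacent (signature (n,n,3)), NOT abc; no side on IUT.
AI-typed; weaker than expert refereeing of the cited inputs.
-/

namespace Summit.Ventures.AbcShadow

open Summit.Ventures.AbcSig (NewformModel FreyDatum OrbitData)
open Literature.NumberTheory.DiophantineGeometry (darmonMerel1997_sumOfPowersEqCube)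

/-! ## The core: a datum in print's normal form at the levels `3p / 9p / 27p` -/

/-- **Core of the generic row, allowed-set-parametric** (= `bvy16_core` of `SH04/PairRow.lean` with the allowed-set function `Aset` as a
parameter: package `BVY04PackageA Aset`, eliminations / distinguished primes / `LStarTransferA` on `Aset`; normal form). `p ≠ 3` prime, `n ≥ 11` prime, `p ≠ n`; levels `N₃ = 3p`, `N₉ = 9p`, `N₂₇ = 27p`
with orbit lists `L₃, L₉, L₂₇` (entries at odd primes not dividing the level); every orbit of `L₃`, `L₉` is kernel-eliminated at `n`;
every orbit of `L₂₇` is kernel-eliminated at `n` OR is an L\* orbit: for some `r`, (i) [kernel, level file] its [Prop 4.2] congruences can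
only hold modulo a prime through which `θ ≡ r` and (ii) [named] `LStarTransfer (27p) o n r 27 (−3)`. Then under `BVY04PackageA Aset`,
`BVY04Prop43`, `BVY04RankInput39` (if `n = 13`) and `DataComplete ×3` there is no datum `A aⁿ + B bⁿ = c³` with `A·B = p^e`,
`1 ≤ e < n`, `Aa, Bb, c` pairwise coprime and nonzero, `3 ∤ Aa`, `Bbⁿ ≢ 2 (mod 3)`, `ab ≠ ±1`. CASE TREE: [L.3.4 + Cor 3.3] give a
newform `f` of level `3p` (`3 ∣ b`), `9p` (`9 ∣ 2 + Bbⁿ − 3c`) or `27p` (`3 ∥ 2 + Bbⁿ − 3c`) with the [Prop 4.2] congruences at `n`;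
`DataComplete` puts `f` in a listed orbit; a kernel tree kills it, or (L\*) `ρ^E_n` arises from a CM-by-`ℚ(√−3)` newform of level 27
and [Prop 4.3] fails: (a) `2` is inert; (b) `n ∉ {5, 7}`, and at `n = 13` `J₀(39)` has a rank-0 quotient over `ℚ(√−3)` while `3 ∤ ab`.
[cite: BennettVatsalYazdani2004, Lemma 3.4 p.1406, Cor 3.3 p.1405, Prop 4.2 pp.1406-1407, Prop 4.3 p.1407] -/
theorem bvy16A_core (p n : ℕ) (hp : p.Prime) (hp3 : p ≠ 3) (hn : n.Prime) (h11 : 11 ≤ n) (hpn : p ≠ n)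
    (M : CMNewformModel) (Aset : ℕ → List ℤ) (hP : M.BVY04PackageA Aset) (h43 : M.BVY04Prop43) (hR39 : n = 13 → M.BVY04RankInput39)
    {N₃ N₉ N₂₇ : ℕ} (h3p : 3 * p = N₃) (h9p : 9 * p = N₉) (h27p : 27 * p = N₂₇) (L₃ L₉ L₂₇ : List OrbitData)
    (hw3 : ∀ o ∈ L₃, ∀ c ∈ o.coeffs, c.ell.Prime ∧ c.ell ≠ 2 ∧ ¬ c.ell ∣ N₃)
    (hw9 : ∀ o ∈ L₉, ∀ c ∈ o.coeffs, c.ell.Prime ∧ c.ell ≠ 2 ∧ ¬ c.ell ∣ N₉)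
    (hw27 : ∀ o ∈ L₂₇, ∀ c ∈ o.coeffs, c.ell.Prime ∧ c.ell ≠ 2 ∧ ¬ c.ell ∣ N₂₇)
    (he3 : ∀ o ∈ L₃, o.Eliminated Aset n) (he9 : ∀ o ∈ L₉, o.Eliminated Aset n)
    (he27 : ∀ o ∈ L₂₇, o.Eliminated Aset n ∨
      ∃ r : ℤ, (∀ f : M.Form N₂₇, M.Matches f o → M.ArisesMod f n Aset →
        MatchesModAt M.toNewformModel f o n Aset r) ∧ M.LStarTransferA Aset N₂₇ o n r 27 (-3))
    (hD3 : M.DataComplete N₃ L₃) (hD9 : M.DataComplete N₉ L₉) (hD27 : M.DataComplete N₂₇ L₂₇)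
    {A B e : ℕ} (he1 : 1 ≤ e) (hen : e < n) (hAB : A * B = p ^ e) {a b c : ℤ}
    (hsol : IsPrimitiveSolution A B 1 n a b c) (h3a : ¬ (3 : ℤ) ∣ (A : ℤ) * a)
    (h3b : ¬ (3 : ℤ) ∣ (B : ℤ) * b ^ n - 2) (hab1 : a * b ≠ 1) (hab2 : a * b ≠ -1) : False := by
  -- arithmetic of the coefficients
  have hpe : 0 < p ^ e := Nat.pow_pos hp.pos
  have hA0 : 0 < A := Nat.pos_of_ne_zero (fun h => by rw [h, zero_mul] at hAB; omega)
  have hB0 : 0 < B := Nat.pos_of_ne_zero (fun h => by rw [h, mul_zero] at hAB; omega)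
  have hAdvd : A ∣ p ^ e := Dvd.intro _ hAB
  have hBdvd : B ∣ p ^ e := Dvd.intro_left _ hAB
  have hfree : ∀ D : ℕ, D ∣ p ^ e → ∀ q : ℕ, q.Prime → ¬ q ^ n ∣ D := by
    intro D hD q hq h
    have hqp : q ∣ p ^ e := (dvd_pow_self q (by omega : n ≠ 0)).trans (h.trans hD)
    have hq : q = p := (Nat.prime_dvd_prime_iff_eq hq hp).mp (hq.dvd_of_dvd_pow hqp)
    subst hq
    have := (Nat.pow_dvd_pow_iff_le_right hq.one_lt).mp (h.trans hD)
    omega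
  have hcube : ∀ q : ℕ, q.Prime → ¬ q ^ 3 ∣ 1 := by
    intro q hq h
    have : q ^ 3 = 1 := Nat.dvd_one.mp h
    rcases pow_eq_one_iff.mp this with h1 | h0
    · exact hq.one_lt.ne' h1
    · exact absurd h0 (by norm_num)
  have hnABC : ¬ n ∣ A * B * 1 := by
    rw [mul_one, hAB]
    intro h
    exact hpn ((Nat.prime_dvd_prime_iff_eq hn hp).mp (hn.dvd_of_dvd_pow h)).symm
  have h3B : ¬ (3 : ℤ) ∣ (B : ℤ) := by
    intro h
    have h' : 3 ∣ B := by exact_mod_cast h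
    exact hp3 ((Nat.prime_dvd_prime_iff_eq Nat.prime_three hp).mp (Nat.prime_three.dvd_of_dvd_pow (h'.trans hBdvd))).symm
  have h3a' : ¬ (3 : ℤ) ∣ a := fun h => h3a (Dvd.dvd.mul_left h _)
  obtain ⟨hL3, hL9, hL27⟩ := bvy04Level_pair p hp hp3 A B e (by omega) hAB
  have h5 : 5 ≤ n := by omega
  have hex1 : ¬ (A * B = 27 ∧ n = 5) := fun h => by omega
  have hex2 : ¬ (A * B = 3 ∧ n = 7) := fun h => by omega
  let S : FreyDatum := ⟨A, B, 1, n, a, b, c⟩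
  have hpkg : ∀ (κ : BVYCase) (N : ℕ), κ.Holds A B 1 n a b c → bvy04Level κ A B 1 = N →
      (∃ f : M.Form N, M.Arises S N f) ∧ (∀ f : M.Form N, M.Arises S N f → M.ArisesMod f n Aset) :=
    fun κ N hκ hN => hP S κ hA0 hB0 Nat.one_pos hcube (fun q hq => ⟨hfree A hAdvd q hq, hfree B hBdvd q hq⟩)
      hn h5 hnABC h3a h3b hsol hab1 hab2 hex1 hex2 hκ N hN
  -- a fully sieved level kills every newform carrying the congruences
  have killAll : ∀ (N : ℕ) (L : List OrbitData), (∀ o ∈ L, ∀ c ∈ o.coeffs, c.ell.Prime ∧ c.ell ≠ 2 ∧ ¬ c.ell ∣ N) →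
      (∀ o ∈ L, o.Eliminated Aset n) → M.DataComplete N L →
      ∀ f : M.Form N, M.ArisesMod f n Aset → False := by
    intro N L hw he hD f hmod
    obtain ⟨o, ho, hfo⟩ := hD f
    exact M.not_arisesMod_of_eliminated f o hfo n Aset (he o ho) (hw o ho) hmod
  -- the case tree of [Cor 3.3]
  by_cases h3 : (3 : ℤ) ∣ (B : ℤ) * b
  · -- `3 ∣ b`: row `ε′₃ = 3`, level `3p`
    have h3b' : (3 : ℤ) ∣ b := (Int.prime_three.dvd_or_dvd h3).resolve_left h3B
    have hκ : BVYCase.bLarge.Holds A B 1 n a b c := by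
      refine ⟨?_, ?_⟩
      · exact Dvd.dvd.mul_left ((pow_dvd_pow (3 : ℤ) (by omega : 4 ≤ n)).trans (pow_dvd_pow_of_dvd h3b' n)) _
      · rintro ⟨h27, -⟩
        exact h3B ((dvd_pow_self 3 (by norm_num)).trans h27)
    obtain ⟨⟨f, hf⟩, hmod⟩ := hpkg .bLarge N₃ hκ (hL3.trans h3p)
    exact killAll N₃ L₃ hw3 he3 hD3 f (hmod f hf)
  · have h3b'' : ¬ (3 : ℤ) ∣ b := fun h => h3 (Dvd.dvd.mul_left h _)
    have h3bn : ¬ (3 : ℤ) ∣ (B : ℤ) * b ^ n := by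
      intro h
      rcases Int.prime_three.dvd_or_dvd h with h' | h'
      · exact h3B h'
      · exact h3b'' (Int.Prime.dvd_pow' (by norm_num) h')
    have hdiv : (3 : ℤ) ∣ 2 + (B : ℤ) * b ^ n - 3 * c := by
      omega
    by_cases h9 : (9 : ℤ) ∣ 2 + (B : ℤ) * b ^ n - 3 * c
    · -- row `ε′₃ = 3²`, level `9p`
      obtain ⟨⟨f, hf⟩, hmod⟩ := hpkg .nine N₉ (by simpa [BVYCase.Holds] using h9) (hL9.trans h9p)
      exact killAll N₉ L₉ hw9 he9 hD9 f (hmod f hf)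
    · -- row `ε′₃ = 3³`, level `27p`: sieve or L\*
      have hκ : BVYCase.three.Holds A B 1 n a b c := ⟨by simpa using hdiv, by simpa using h9⟩
      obtain ⟨⟨f, hf⟩, hmod⟩ := hpkg .three N₂₇ hκ (hL27.trans h27p)
      have hmodf := hmod f hf
      obtain ⟨o, ho, hfo⟩ := hD27 f
      rcases he27 o ho with helim | ⟨r, hAt, hL⟩
      · exact M.not_arisesMod_of_eliminated f o hfo n Aset helim (hw27 o ho) hmodf
      · -- the L\* orbit: `ρ^E_n` arises from a CM-by-`ℚ(√−3)` newform of level 27; [Prop 4.3] fails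
        obtain ⟨g, hCM, hg⟩ := hL S rfl hsol hab1 hab2 f hf (hAt f hfo hmodf)
        have hsq : Squarefree (-3 : ℤ) := by
          rw [← Int.squarefree_natAbs]
          exact Nat.prime_three.squarefree
        rcases h43 S 27 g (-3) hA0 hB0 Nat.one_pos hcube (fun q hq => ⟨hfree A hAdvd q hq, hfree B hBdvd q hq⟩)
            hn h5 h3a h3b hsol hab1 hab2 hg (by norm_num) hsq hCM with ⟨-, -, hs2⟩ | ⟨hn513, -, halt⟩
        · -- (a): `2` would have to split in `ℚ(√−3)`; it is inert (`−3 ≢ 1 (mod 8)`)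
          simp [QuadSplits] at hs2
        · have hSn : S.n = n := rfl
          rw [hSn] at hn513 halt
          rcases hn513 with h5' | h7' | h13'
          · omega
          · omega
          · rcases halt with hJ | ⟨⟨r', s, hs, hrs⟩, -⟩
            · -- `n = 13`: `J₀(39)` has a rank-0 quotient over `ℚ(√−3)` [BVY04 p.1407, Kamienny]
              rw [h13'] at hJ
              exact hJ (hR39 h13')
            · -- `ab = ±2^r 3^s`, `s > 0` would force `3 ∣ ab`; but `3 ∤ a` (normal form) and `3 ∤ b` (level `27p`)
              have h3ab : (3 : ℤ) ∣ a * b := by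
                have h3 : (3 : ℤ) ∣ 2 ^ r' * 3 ^ s := Dvd.dvd.mul_left (dvd_pow_self 3 hs.ne') _
                rcases hrs with h | h
                · exact (show S.a * S.b = a * b from rfl) ▸ h ▸ h3
                · exact (show S.a * S.b = a * b from rfl) ▸ h ▸ h3.neg_right
              rcases Int.prime_three.dvd_or_dvd h3ab with h | h
              · exact h3a' h
              · exact h3b'' h

/-! ## The generic row -/

/-- **Generic row for `n ∤ α`, allowed-set-parametric (no Darmon–Merel input).** Under the hypotheses of `bvy16A_core`, `xⁿ + p^α yⁿ = z³` has no solution in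
pairwise coprime integers with `|xy| > 1` when `n ∤ α`, `α ≥ 1`. Kernel steps (uniform in `(p, n)`): `p ∤ xz`; `α = nk + e`,
`Y = p^k y`, `1 ≤ e < n`; coprimality of `(x, p^{e+k} y, z)`; `|xY| > 1`; print's normal form via `(A,a) ↔ (B,b)` (`3 ∣ x`) and
`(a,b,c) ↦ (−a,−b,−c)` (`p^e Yⁿ ≡ 2 (mod 3)`); then `bvy16A_core`.
[cite: BennettVatsalYazdani2004, Thm 1.6 p.1400 (one pair (p,n)); Lemma 3.4, Cor 3.3, Prop 4.2, Prop 4.3] -/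
theorem bvy16A_pair_of_not_dvd (p n : ℕ) (hp : p.Prime) (hp3 : p ≠ 3) (hn : n.Prime) (h11 : 11 ≤ n) (hpn : p ≠ n)
    (M : CMNewformModel) (Aset : ℕ → List ℤ) (hP : M.BVY04PackageA Aset) (h43 : M.BVY04Prop43) (hR39 : n = 13 → M.BVY04RankInput39)
    {N₃ N₉ N₂₇ : ℕ} (h3p : 3 * p = N₃) (h9p : 9 * p = N₉) (h27p : 27 * p = N₂₇) (L₃ L₉ L₂₇ : List OrbitData)
    (hw3 : ∀ o ∈ L₃, ∀ c ∈ o.coeffs, c.ell.Prime ∧ c.ell ≠ 2 ∧ ¬ c.ell ∣ N₃)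
    (hw9 : ∀ o ∈ L₉, ∀ c ∈ o.coeffs, c.ell.Prime ∧ c.ell ≠ 2 ∧ ¬ c.ell ∣ N₉)
    (hw27 : ∀ o ∈ L₂₇, ∀ c ∈ o.coeffs, c.ell.Prime ∧ c.ell ≠ 2 ∧ ¬ c.ell ∣ N₂₇)
    (he3 : ∀ o ∈ L₃, o.Eliminated Aset n) (he9 : ∀ o ∈ L₉, o.Eliminated Aset n)
    (he27 : ∀ o ∈ L₂₇, o.Eliminated Aset n ∨
      ∃ r : ℤ, (∀ f : M.Form N₂₇, M.Matches f o → M.ArisesMod f n Aset →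
        MatchesModAt M.toNewformModel f o n Aset r) ∧ M.LStarTransferA Aset N₂₇ o n r 27 (-3))
    (hD3 : M.DataComplete N₃ L₃) (hD9 : M.DataComplete N₉ L₉) (hD27 : M.DataComplete N₂₇ L₂₇)
    (α : ℕ) (hα : 0 < α) (hnα : ¬ n ∣ α) (x y z : ℤ) (hxy : IsCoprime x y) (hxz : IsCoprime x z)
    (hyz : IsCoprime y z) (hbig : 1 < |x * y|) (heq : x ^ n + (p : ℤ) ^ α * y ^ n = z ^ 3) : False := by
  have hn0 : 0 < n := by omega
  have hodd : Odd n := hn.odd_of_ne_two (by omega)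
  obtain ⟨hpx, hpz⟩ := sh04_prime_not_dvd hp hα hn0 hxz heq
  -- `α = n k + e`, `1 ≤ e < n`
  set k := α / n with hk
  set e := α % n with he
  have hαke : α = n * k + e := (Nat.div_add_mod α n).symm
  have he1 : 1 ≤ e := Nat.pos_of_ne_zero (fun h0 => hnα (Nat.dvd_of_mod_eq_zero h0))
  have hen : e < n := Nat.mod_lt α hn0
  set Y : ℤ := (p : ℤ) ^ k * y with hY
  have hpow : (p : ℤ) ^ α * y ^ n = ((p ^ e : ℕ) : ℤ) * Y ^ n := by
    rw [hαke, hY]; push_cast; ring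
  -- nonvanishing and coprimality
  have hx0 : x ≠ 0 := by rintro rfl; simp at hbig
  have hy0 : y ≠ 0 := by rintro rfl; simp at hbig
  have hz0 : z ≠ 0 := by
    rintro rfl
    have hx1 := Int.isUnit_iff_abs_eq.mp (isCoprime_zero_right.mp hxz)
    have hy1 := Int.isUnit_iff_abs_eq.mp (isCoprime_zero_right.mp hyz)
    rw [abs_mul, hx1, hy1] at hbig
    norm_num at hbig
  have pP : Prime (p : ℤ) := Int.prime_iff_natAbs_prime.mpr (by simpa using hp)
  have hcpx : IsCoprime (p : ℤ) x := pP.irreducible.coprime_iff_not_dvd.mpr hpx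
  have hcpz : IsCoprime (p : ℤ) z := pP.irreducible.coprime_iff_not_dvd.mpr hpz
  have hBY : ((p ^ e : ℕ) : ℤ) * Y = (p : ℤ) ^ (e + k) * y := by rw [hY]; push_cast; ring
  have hxBY : IsCoprime x (((p ^ e : ℕ) : ℤ) * Y) := by
    rw [hBY]
    exact (hcpx.symm.pow_right).mul_right hxy
  have hBYz : IsCoprime (((p ^ e : ℕ) : ℤ) * Y) z := by
    rw [hBY]
    exact (hcpz.pow_left).mul_left hyz
  have hBY0 : ((p ^ e : ℕ) : ℤ) * Y ≠ 0 := by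
    rw [hBY]; exact mul_ne_zero (pow_ne_zero _ (by exact_mod_cast hp.ne_zero)) hy0
  have h1p : (1 : ℤ) ≤ |(p : ℤ)| := by
    rw [Nat.abs_cast]; exact_mod_cast hp.one_lt.le
  have hxY : x * Y ≠ 1 ∧ x * Y ≠ -1 := by
    have hlt : 1 < |x * Y| := by
      rw [hY, show x * ((p : ℤ) ^ k * y) = (p : ℤ) ^ k * (x * y) by ring, abs_mul]
      calc (1 : ℤ) = 1 * 1 := by norm_num
        _ < |(p : ℤ) ^ k| * |x * y| := by
          apply mul_lt_mul' _ hbig (by norm_num) (abs_pos.mpr (pow_ne_zero _ (by exact_mod_cast hp.ne_zero)))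
          rw [abs_pow]; exact one_le_pow₀ h1p
    constructor <;> intro h <;> rw [h] at hlt <;> norm_num at hlt
  have heq' : x ^ n + ((p ^ e : ℕ) : ℤ) * Y ^ n = z ^ 3 := by rw [← hpow]; exact heq
  have hAB1 : 1 * p ^ e = p ^ e := one_mul _
  have hAB2 : p ^ e * 1 = p ^ e := mul_one _
  have hnx : (-x) ^ n = -(x ^ n) := Odd.neg_pow hodd x
  have hnY : (-Y) ^ n = -(Y ^ n) := Odd.neg_pow hodd Y
  have hnz : (-z) ^ 3 = -(z ^ 3) := Odd.neg_pow (by decide) z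
  -- print's normal form
  by_cases h3x : (3 : ℤ) ∣ x
  · -- swap: `A = p^e`, `a = Y`, `B = 1`, `b = x`
    refine bvy16A_core p n hp hp3 hn h11 hpn M Aset hP h43 hR39 h3p h9p h27p L₃ L₉ L₂₇ hw3 hw9 hw27 he3 he9 he27 hD3 hD9 hD27
      he1 hen hAB2 (a := Y) (b := x) (c := z)
      ⟨by rw [← heq']; push_cast; ring, hBY0, by simpa using hx0, by simpa using hz0, by simpa using hxBY.symm,
        by simpa using hBYz, by simpa using hxz⟩ ?_ ?_ (by rw [mul_comm]; exact hxY.1) (by rw [mul_comm]; exact hxY.2)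
    · intro h3
      have hu : IsUnit (3 : ℤ) := hxBY.isUnit_of_dvd' h3x h3
      rcases Int.isUnit_iff.mp hu with h | h <;> norm_num at h
    · have : (3 : ℤ) ∣ x ^ n := dvd_pow h3x (by omega)
      push_cast
      omega
  · by_cases h3b : (3 : ℤ) ∣ ((p ^ e : ℕ) : ℤ) * Y ^ n - 2
    · -- sign change: `(a, b, c) = (−x, −Y, −z)`
      refine bvy16A_core p n hp hp3 hn h11 hpn M Aset hP h43 hR39 h3p h9p h27p L₃ L₉ L₂₇ hw3 hw9 hw27 he3 he9 he27 hD3 hD9 hD27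
        he1 hen hAB1 (a := -x) (b := -Y) (c := -z)
        ⟨?_, by simpa using hx0, by simpa using hBY0, by simpa using hz0, by simpa using hxBY.neg_neg,
          by simpa using hxz.neg_neg, by simpa using hBYz.neg_neg⟩ (by simpa using h3x) ?_
        (by rw [neg_mul_neg]; exact hxY.1) (by rw [neg_mul_neg]; exact hxY.2)
      · rw [Nat.cast_one, one_mul, one_mul, hnx, hnY, hnz, ← heq']
        ring
      · rw [hnY, mul_neg]
        omega
    · -- already normal: `(a, b, c) = (x, Y, z)`
      exact bvy16A_core p n hp hp3 hn h11 hpn M Aset hP h43 hR39 h3p h9p h27p L₃ L₉ L₂₇ hw3 hw9 hw27 he3 he9 he27 hD3 hD9 hD27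
        he1 hen hAB1 (a := x) (b := Y) (c := z)
        ⟨by rw [← heq']; push_cast; ring, by simpa using hx0, hBY0, by simpa using hz0, by simpa using hxBY,
          by simpa using hxz, by simpa using hBYz⟩ (by simpa using h3x) h3b hxY.1 hxY.2

/-- **Generic row `(p, n)` of [BVY04, Thm 1.6], allowed-set-parametric (reduction theorem).** Under the named hypotheses of `bvy16A_core` and [DM97] for the
sub-case `n ∣ α` (then `p^α yⁿ = (p^k y)ⁿ` and the equation is `xⁿ + Yⁿ = z³`), the equation `xⁿ + p^α yⁿ = z³` has no solution in
pairwise coprime integers with `|xy| > 1` for any `α ≥ 1`: `SH04Pair p n`. ADJACENT, NOT abc.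
[cite: BennettVatsalYazdani2004, Thm 1.6 p.1400 (one pair (p,n), conditionally on the named inputs)] -/
theorem bvy16A_pair (p n : ℕ) (hp : p.Prime) (hp3 : p ≠ 3) (hn : n.Prime) (h11 : 11 ≤ n) (hpn : p ≠ n)
    (M : CMNewformModel) (Aset : ℕ → List ℤ) (hP : M.BVY04PackageA Aset) (h43 : M.BVY04Prop43) (hR39 : n = 13 → M.BVY04RankInput39)
    {N₃ N₉ N₂₇ : ℕ} (h3p : 3 * p = N₃) (h9p : 9 * p = N₉) (h27p : 27 * p = N₂₇) (L₃ L₉ L₂₇ : List OrbitData)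
    (hw3 : ∀ o ∈ L₃, ∀ c ∈ o.coeffs, c.ell.Prime ∧ c.ell ≠ 2 ∧ ¬ c.ell ∣ N₃)
    (hw9 : ∀ o ∈ L₉, ∀ c ∈ o.coeffs, c.ell.Prime ∧ c.ell ≠ 2 ∧ ¬ c.ell ∣ N₉)
    (hw27 : ∀ o ∈ L₂₇, ∀ c ∈ o.coeffs, c.ell.Prime ∧ c.ell ≠ 2 ∧ ¬ c.ell ∣ N₂₇)
    (he3 : ∀ o ∈ L₃, o.Eliminated Aset n) (he9 : ∀ o ∈ L₉, o.Eliminated Aset n)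
    (he27 : ∀ o ∈ L₂₇, o.Eliminated Aset n ∨
      ∃ r : ℤ, (∀ f : M.Form N₂₇, M.Matches f o → M.ArisesMod f n Aset →
        MatchesModAt M.toNewformModel f o n Aset r) ∧ M.LStarTransferA Aset N₂₇ o n r 27 (-3))
    (hD3 : M.DataComplete N₃ L₃) (hD9 : M.DataComplete N₉ L₉) (hD27 : M.DataComplete N₂₇ L₂₇)
    (hDM : darmonMerel1997_sumOfPowersEqCube) : SH04Pair p n := by
  intro α hα x y z hxy hxz hyz hbig heq
  by_cases hnα : n ∣ α
  · -- `α = n k`: `xⁿ + (p^k y)ⁿ = z³`, excluded by [DM97]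
    obtain ⟨k, rfl⟩ := hnα
    obtain ⟨hpx, -⟩ := sh04_prime_not_dvd hp hα (by omega : 0 < n) hxz heq
    have pP : Prime (p : ℤ) := Int.prime_iff_natAbs_prime.mpr (by simpa using hp)
    have hcpx : IsCoprime (p : ℤ) x := pP.irreducible.coprime_iff_not_dvd.mpr hpx
    have hxY : IsCoprime x ((p : ℤ) ^ k * y) := (hcpx.symm.pow_right).mul_right hxy
    have hz0 : z ≠ 0 := by
      rintro rfl
      have hx1 := Int.isUnit_iff_abs_eq.mp (isCoprime_zero_right.mp hxz)
      have hy1 := Int.isUnit_iff_abs_eq.mp (isCoprime_zero_right.mp hyz)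
      rw [abs_mul, hx1, hy1] at hbig
      norm_num at hbig
    have h1p : (1 : ℤ) ≤ |(p : ℤ)| := by
      rw [Nat.abs_cast]; exact_mod_cast hp.one_lt.le
    have hbig' : 1 < |x * ((p : ℤ) ^ k * y)| := by
      rw [show x * ((p : ℤ) ^ k * y) = (p : ℤ) ^ k * (x * y) by ring, abs_mul]
      calc (1 : ℤ) = 1 * 1 := by norm_num
        _ < |(p : ℤ) ^ k| * |x * y| := by
          apply mul_lt_mul' _ hbig (by norm_num) (abs_pos.mpr (pow_ne_zero _ (by exact_mod_cast hp.ne_zero)))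
          rw [abs_pow]; exact one_le_pow₀ h1p
    refine Literature.NumberTheory.DiophantineGeometry.BennettVatsalYazdani2004.thm81_one_of_darmonMerel hDM
      (n := n) (by omega) hz0 hxY hbig' ?_
    rw [one_mul, ← heq]
    ring
  · exact bvy16A_pair_of_not_dvd p n hp hp3 hn h11 hpn M Aset hP h43 hR39 h3p h9p h27p L₃ L₉ L₂₇ hw3 hw9 hw27 he3 he9 he27
      hD3 hD9 hD27 α hα hnα x y z hxy hxz hyz hbig heq

end Summit.Ventures.AbcShadow
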